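import Summits.BirchSwinnertonDyer.BirchSwinnertonDyer.Theorems.ErratumRoadFiveBdvCalibrationSplitNFCalibratorDefs
import HarnessLib

/-!
# The BDV-calibration split of `A♭-fam` — NEWFORM-SHAPED calibrator `S2-NF` ON R: the PROVED recompositions to `AFlatFamStatementR`
# (crux stmt-BirchSwinnertonDyer-19715, (α2) item stmt-BirchSwinnertonDyer-33169; deliverable (622)(1) of idea-9, PORTED — d2R P2)

Third of the three modules of the BUILT port (LEAD `bsd-line-er5-p1` g20) of the crux WORKFILE
`Cruxes/EulerHalfNotRamNoInertSetAtFive/Lines/bdv_calibration_split_nf_Sketch.lean` rev 1.2.1 (commit 1a3edf267b08, 950 l., sha16 402b542340c4b640; critic idea-crit-14 V381 PASS on rev 1.2, rev 1.2.1 = docstring-only touch-up paying V381 N1–N4; FROZEN for d2R);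
provenance and §A–§G in the module docstrings of `ErratumRoadFiveBdvCalibrationSplitNFDefs` ∕ `…NFCalibratorDefs`.  THIS is the module
a registry line imports for the NF road (`Summits.BirchSwinnertonDyer.BirchSwinnertonDyer.Theorems.ErratumRoadFiveBdvCalibrationSplitNF`),
next to `…Theorems.ErratumRoadFiveBstwDoorValuationIneqR` (d2R P1), whose BY-NAME entry
`ErratumRoadFiveBstwDoor.katoValuationIneqNonsplitAtFive_of_aFlatFamR : S0′ → AFlatFamStatementR → Theses.ErratumRoadFive.KatoValuationIneqNonsplitAtFive`
consumes EXACTLY the `AFlatFamStatementR` (p806950) the glues below conclude — pen r3 shape of record (2026-08-31T03:36:39Z):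
`KatoValuationIneqNonsplitAtFive_of := katoValuationIneqNonsplitAtFive_of_aFlatFamR stub_printedFactsHeldNonsplit
(aFlatFamR_of_bdvCalibrationPiecesNFR ⟨stub_calibratorSupplyNF, stub_portPiecesNFR⟩)`.

Proved here (workfile texts 1:1): `aFlatFamR_of_bdvChainNFR_of_calibrationNF`, `eisensteinPeriodRatioValuationNF_of_supply_of_port`,
`aFlatFamR_of_bdvChainNFR_of_supply_of_port`, `shift_eq_zero_of_datum`, `aFlatFamR_of_bdvCalibrationNFR` (MERGED text),
`aFlatFamR_of_bdvCalibrationPiecesNFR` (PIECES text).  Two port certificates are added (one-liners, not in the workfile):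
`bdvChainExplicitNonsplitR_iff_exists_curveConjunctR : BdvChainExplicitNonsplitR ↔ ∃ V, BdvChainCurveConjunctR V` (`Iff.rfl` — the
§0 conjunct IS the matrix of the P1 constant S1R) and `bdvChainExplicitNonsplitR_of_bdvChainExplicitNFR` (S1-NF-on-R projects onto S1R).

NOTHING here proves S1-NF, S2-NF, S2a/b/c-NF, `BdvCalibrationNFR`, `BdvCalibrationPiecesNFR` (all OPEN, hypotheses of every
theorem), nor 33169, 33168, 19715 or any route item; no summit statement is proved; typed ≠ proved; BSD is proved for no curve.
Workfile docstring §H (rev 1.2: S1-NF on the R curve conjunct; the NF chain's own index named) follows verbatim.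

## H. rev 1.2 (g51, 2026-08-31) — S1-NF ON THE R CURVE CONJUNCT; THE NF CHAIN'S OWN INDEX NAMED

Asked by pen g52 (`pub/bsd-stepL/STATUS.md` 2026-08-31T03:03:23Z: repair (α) = S1R CHOSEN, TOTIENT spelling; d2R P2 gated on
this rev) and critic idea-crit-14 V379 (NF note).  Inputs: memo `Lines/bdv22_o4_erho_level.md` rev 1.4 (A6)/(A7); typer
ty-snf g1 T0′ memo (`pub/bsd-stepL/ty-snf/g1/T0PRIME-MEMO.md`, Q1–Q4); S1R sketch `Lines/bdv_explicit_exponent_R_Sketch.lean`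
rev 1.2.  Every BSTW locator below is arXiv:2409.01350v1 as materialised (`pNNNN.txt:L`).

(H1) R CURVE CONJUNCT.  `BdvChainCurveConjunctR V`, `AFlatFamStatementR`, `BdvChainExplicitNFR P` (and the bundled
`BdvCalibrationNFR`, `BdvCalibrationPiecesNFR`) = the rev 1.1 texts with the ONE amendment of S1R in the pen's TOTIENT spelling:
exponent `bdvExplicitExponentR … v N := bdvExplicitExponent … v − v_p(φ(N))`, `N` the level binder of `f : CuspForm (Gamma0 N) 2`
(`IsNewformOf W f`, so `N = N_W`; `p ∥ N_W` and `p ∤ p − 1` give `v_p φ(N_W) = v_p φ(N_W/p) = v_p ι_{N_W/p}`), written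
`− (padicValNat p (Nat.totient N) : ℤ)` right after the KEPT Γ₀ pair `(congruenceNumber Dt.f, D.modularDegree)`; zero new
notions; on `p ∤ φ(N)` it IS the rev 1.1 exponent (`bdvExplicitExponentR_eq_of_not_dvd_totient`).  Reason (typer T0′ = memo rev
1.4): BDV's unit `A` carries KLZ's `Γ₁(N_f)`-Petersson, booked nowhere else in print or frame.  All glue is re-proved on R
(`aFlatFamR_of_…`).  The LEAD's `Theorems/ErratumRoadFiveBdvCalibrationSplitR.lean` (d2R P1) is the decl of record for
`AFlatFamStatementR`/`BdvChainExplicitNonsplitR` once landed; the copies here serve the NF port (P2) and must then agree token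
for token (the pen keys 33169 r3 once, after P1 + P2).

(H2) THE NF CHAIN'S OWN INDEX — NAMED.  It is BSTW's `Γ₁(N_g)`-CONGRUENCE NUMBER `c̃_g` [(congruence) p.15 L43:
`c_g·O = φ_{Γ₁(N),O}(Ann_𝕋(𝔭_g))·O`], and it is NOT «identically absent» (rev 1.1 §A, §F O3, S2-NF docstring — the same currency
slip as memo e9, logged e10 below): BSTW's `O`-bases of `T^±_{O,g}` are `γ_g^± = δ_g^±/c̃_g` [Lemma 1.5 (ii) p.15 L21–31], and a
GOOD differential is an `O`-basis of the QUOTIENT lattice `S_O` [def. p.14 L60–77], i.e. `ω_g/c̃_g` up to `O^×` [Lemma 1.5 (i)],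
not `ω_g`.  BSTW's PRINTED PAIR: the class `z_Kato(g)` of (log-Kato-elt-1) is the specialisation of `𝐳_γ(g)` [p.59 L20–25] for
the `γ` CHOSEN at p.60 L4–5 («`γ^±` an `O`-basis of `T^±_{O,g}`»), i.e. `𝐳_{γ_g} = 𝐳_{δ_g}/c̃_g` (`𝐳_γ` is `F_λ`-linear in
`γ`, §1.2.9 p.22); the logarithm is `log_BK^{η_{ω_g}}` along the FIXED newform differential `ω_g ↔ 2πi·g(z)dz` [p.60 L36–44,
with `log_{ω_g}(y_L)` on the right; `η_ω` is defined by `φ(η_ω) = α η_ω`, `[ω, η_ω] = 1`, p.17 L69–70, so `η_{ω/c} = c·η_ω` and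
`log^{η_{ω/c}} = c⁻¹·log^{η_ω}`].  Write the NF datum's value functional `Λ` (D2, (C4)) as «`exp*` read in the coordinate of a
differential `ω_Λ`» and its `HasBKLog` (D3) as «along `η_{ω_log}`».  The value law (C5) pins `Λ(z) = q′·L/Ω_opt·R′`, and
`exp*(𝐳_γ) = (L/Ω⁺_{ω,γ})·ω` for every `ω` [periods `Ω^±_{ω,γ}`: p.14 L96–121; `Ω_{ω/c,γ} = Ω_{ω,γ}/c`, `Ω_{ω,γ/c} = c·Ω_{ω,γ}`,
whence `Ω_{ω_g/c̃_g, γ_g} = Ω_{ω_g, δ_g} = Ω_opt`], so the pinned bottom class is `q′·𝐳_{γ_g}` if `ω_Λ` is good and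
`q′·𝐳_{δ_g} = q′·c̃_g·𝐳_{γ_g}` if `ω_Λ = ω_g`.  Therefore
    `σ′ = c̃_g^m · σ_BSTW · (q′R′∏E′_ℓ-conversion)`,    `m(port) = a − b ∈ {−1, 0, +1}`,
    `a = 1` iff `ω_Λ = ω_g` (`a = 0` iff `ω_Λ` good),    `b = 1` iff `ω_log` good (`b = 0` iff `ω_log = ω_g`, AS PRINTED),
and the exact NF crossing identity is `‖X′‖ = rhs · ‖c̃_g‖_λ^{−m}` with `rhs` as typed (`‖c̃_g‖_λ := ‖ι′⁻¹ c̃_g‖ ≤ 1`).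
rev 1.1 was INCONSISTENT: its `rhs` is exact iff `m = 0`, while its D2 docstring («`exp*` read through a good `ω`», `a = 0`) and
its D3 docstring («`log_BK^{η_ω}` for SOME good `ω`», `b = 1`) declare `m = −1`.
rev 1.2 DECISION — the port is PINNED to BSTW's literal pair `(a, b) = (0, 0)`, `m = 0`: D2's `Λ` reads `exp*` in the coordinate
of the GOOD differential `ω_g/c̃_g` (kept; so the pinned bottom class is `q′·𝐳_{γ_g}`, BSTW's own) and D3's `HasBKLog` is
`log_BK^{η_{ω_g}}` along the FIXED `ω_g` (CHANGED from «some good `ω`»).  Under this pinning `c̃_g` is ABSENT FROM `rhs` — by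
pinning, not identically: it is PRESENT in the class normalisation, and constructing `Λ` requires it (the good differential is
`ω_g/c̃_g`), so it is NAMED in Lean — `NFPort.IsCongruenceGenerator` (posited second interface field; construction = port
obligation; BSTW (congruence), (cong-formula) p.15 L43–56) and the datum fields `congrIdx`, `congrIdx_spec`, `congrIdx_ne`.  The
`c̃`-free CANONICAL alternative `(a, b) = (1, 0)` (both along `ω_g` — the twin of the curve side's Néron/`ω_E` reading) has
`m = +1` and exact right-hand side `NFCalibratorDatum.rhsCanonical D = D.rhs / ‖D.congrIdx‖` (`= D.rhs` when `‖c̃_g‖_λ = 1`: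
`rhsCanonical_eq_rhs_of_norm_eq_one`); a port choosing it swaps `rhs` for `rhsCanonical` in S1-NF/S2-NF/S2c-NF — every glue
theorem below is insensitive to the swap (they use the identities only as equations between `‖X′‖` and a non-zero real).
SAME TABLE, CURVE COLUMN (consistency with T0′): the registered frame pins the curve class in Néron `ω_W`-VALUE currency
(`HasLocPKummerLog` = formal-group logarithm along `ω_W = c·ω_f`, Manin `c` booked as `ord_p c`; `plusPeriod f = perRatio·Ω_W⁺`):
`(a, b) = (1, 0)`, `m = +1` — the curve column carries `c̃^{Γ₁}(f_W)` ONCE, and at a good-image `p ∥ N_W`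
`c̃^{Γ₁}(f_W) ∼_p ι_{N_W/p} · m_W^{X₀}` [(Γ₁-ARS) dictionary of the memo: Tilouine 1997 Thm 3.4 + Cor., ARS12 Thm 2.1, Mazur78;
BSTW Rem. 1.7 p.15 L57–60 at `p ∤ 2N`] = T0's booked Petersson→Néron `m`-row + S1R's `v_p φ(N)` — exactly (H1).  So in the
calibration `Δ = (a) − (b)` each column books its own Γ₁ congruence number with its own multiplicity — curve `+1` (rows `m`, `ι`),
NF `0` (pinning) — and «one `V`» (§D) is unaffected: BDV's (38) for a newform member `g`, re-expressed in the `(0,0)` currency,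
books `+(ι_{N_g} + m_g)` (its `A_g`-row and its Petersson→period row) and `−c̃_g` (class conversion `𝐳_{δ_g} ↦ 𝐳_{γ_g}`), net
`0` by Rem. 1.7 — consistent with S2c-NF's exactness and `V ≡ 0`.
(H3) BY-HYPOTHESIS VARIANT (recorded, NOT adopted as a field): if `λ ∤ c̃_g` the four pinnings agree and `rhs = rhsCanonical`.
For a RATIONAL calibrator this is typable today as `¬ p ∣ Nat.totient N ∧ ¬ p ∣ congruenceNumber g` (no Dirichlet character
mod `N` of `p`-power order ⇒ `𝕋_{Γ₁(N),𝔪} = 𝕋_{Γ₀(N),𝔪}`; tree `congruenceNumber` = ARS `r_g`, meaningful for integral `g` only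
— docstring of `CongruenceNumber.congruenceNumber`); but S2a-NF's printed supply (`g_ψ`, CM) is non-rational in general and the
general notion (ARS12 §3, `S₂(ℤ)[I_g]`) is not in the tree — left to the supply seat (C2) as an optional convenience.
(H4) NOT claimed here: the `m`-row inside T0's `𝔇` (F1′(b), research seat); BSV21b/MTT86 normalisations (c3, c6; acq-14925,
acq-00040).  Both conventions for `log^{η}` (coefficient along `η_ω`; pairing with `ω`) scale as `c⁻¹` under `ω ↦ ω/c`, so
the sign of `b` is convention-free.  Desk test for the critic: BSTW's own Thm. 6.4 at a rational `g = f_E` with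
`p ∤ 2N·m_E·φ(N)`: all pinnings coincide, `‖c̃_g‖_λ = 1`, and (log-Kato-elt-1) is `‖X′‖ = rhs` verbatim.
(H5) critic V381 (PASS) notes, paid rev 1.2.1.  N1: `bdvExplicitExponentR` has TWO sketch copies (here, inline; S1R sketch rev 1.3,
now the SAME inline body + `bdvExplicitExponentR_eq_sub`) — the TREE gets ONE definition, the LEAD's er5 F1 (`…BdvCalibrationSplitR`/RDefs);
the d2R P2 port IMPORTS F1 and does NOT port this namespace's local copy.  N2 (convention of `b` PINNED): «along `η_ω`» := the
`η_ω`-COORDINATE of `log_BK x` in the basis `(ω, η_ω)` of `D_dR` modulo `Fil⁰ = F_λ·ω` (equivalently `±[log_BK x, ω]`, well-defined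
because `Fil¹` is isotropic); both readings scale as `c⁻¹` under `ω ↦ ω/c` (`η_{ω/c} = c·η_ω`), so `b`'s sign is as in (H2); a pairing
against `η_ω` itself is NOT well-defined on `D_dR/Fil⁰` and is not meant.  N3: the `(0,0)` PORT PINNING is ONE declaration carried on
THREE docstrings — `ZetaBodyNF` (`a = 0`: `Λ` in the good-`ω` coordinate), `NFPort.HasBKLog` (`b = 0`: along `η_{ω_g}`),
`NFPort.IsCongruenceGenerator` (`c̃_g`) — and must be PORTED TOGETHER (a port changing one of them changes `m` and must swap
`rhs ↦ rhs·‖c̃_g‖_λ^{−m}`).  N4 (row anchors): KLZ17 Thm. 2.7.4 (arXiv:1503.02888 p.12 L46–76, the `Γ₁(N_f)`-Petersson in the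
reciprocity law) and BDV22 (30) (preprint p.30 / journal p.36, carrying `A` to `k_o`) sit next to «KLZ17 Thm. 10.2.2» / «BDV22 Thm. 3.1
(25) p.31» as the anchors of the S1R row.  N5: e10 owned.
e10 (errata, rev 1.1 → 1.2): §A «`γ^± = δ_g^±`» and «IDENTICALLY ABSENT»; §F O3 «`c_g` does NOT occur» (true for the Manin-type
constant `φ_A^*ω_A = c_g ω_g` of a quotient `A`; false as a statement about the CONGRUENCE number `c̃_g`, which occurs in the
class); S2-NF docstring «`γ = δ_g`» (now `γ = γ_g = δ_g/c̃_g`).  NOTHING here proves a summit statement; BSD is proved for no curve.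
-/

set_option autoImplicit false
-- D-0017: single-problem summit, so `Summit.BirchSwinnertonDyer.BirchSwinnertonDyer.…` repeats a namespace BY DESIGN.
set_option linter.dupNamespace false

noncomputable section

open scoped Classical NumberField TensorProduct BigOperators Pointwise

namespace Summit.BirchSwinnertonDyer.BirchSwinnertonDyer.Theorems.ErratumRoadFiveBdvCalibrationSplitNF

open Field
open Literature.NumberTheory.GaloisRepresentations
open Literature.NumberTheory.EllipticCurves Literature.NumberTheory.EllipticCurves.Kato2004
open Literature.NumberTheory.EllipticCurves.Kato2004.EulerSystemValues
open Literature.NumberTheory.EllipticCurves.Rank1Residual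
open Literature.NumberTheory.EllipticCurves.Rank1Residual.Typed
open Literature.NumberTheory.EllipticCurves.ModularForms
open Literature.NumberTheory.EllipticCurves.Castella2018
open Summit.BirchSwinnertonDyer.Rank1Residual
open Summit.BirchSwinnertonDyer.BirchSwinnertonDyer.Theorems.ErratumRoadFiveBdvCalibrationSplit
open Summit.BirchSwinnertonDyer.BirchSwinnertonDyer.Theorems.ErratumRoadFiveBdvCalibrationSplitR
open IsDedekindDomain (HeightOneSpectrum)
open CongruenceSubgroup (Gamma0)
open Rat.HeightOneSpectrum (primesEquiv)

/-! ## §0 Port certificates: the NF-on-R port sits OVER the d2R-P1 constants -/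

/-- The §0 curve conjunct on R of `ErratumRoadFiveBdvCalibrationSplitNFDefs` IS the matrix of the P1 constant S1R
`ErratumRoadFiveBdvCalibrationSplitR.BdvChainExplicitNonsplitR` (p806950): the two agree definitionally (`Iff.rfl`). -/
theorem bdvChainExplicitNonsplitR_iff_exists_curveConjunctR :
    BdvChainExplicitNonsplitR ↔ ∃ V : ℕ → ℤ → ℤ, BdvChainCurveConjunctR V :=
  Iff.rfl

/-- S1-NF-on-R projects onto the P1 constant S1R `BdvChainExplicitNonsplitR` (forget the newform conjunct). -/
theorem bdvChainExplicitNonsplitR_of_bdvChainExplicitNFR (P : NFPort) (h : BdvChainExplicitNFR P) :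
    BdvChainExplicitNonsplitR := by
  obtain ⟨V, hV, _⟩ := h
  exact ⟨V, hV⟩

/-! ## §3 The PROVED recomposition over S1-NF-on-R ∧ S2-NF — conclusion = the IMPORTED `AFlatFamStatementR` (p806950) -/

/-- **The proved recomposition over S2-NF (gate (i) shape of deliverable 1, newform calibrator).**  Conclusion =
`AFlatFamStatementR` (= registered stub statement, token for token).  Proof: S2-NF at `(L, p)` yields a datum with `X′ ≠ 0`
and exact identity; S1-NF's newform conjunct at the same datum yields the identity shifted by `p^{−V p d_L}`; hence
`p^{−V p d_L} = 1`, `V p d_L = 0` (`zpow` injective, `p > 1`); S1-NF's curve conjunct at the target (a class member by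
`nonExceptionalRankOneAt_of_classX11b`) with `V p d_L = 0` and `bdvExplicitExponentR_of_not_split` is the registered exponent with the S1R term (R). -/
theorem aFlatFamR_of_bdvChainNFR_of_calibrationNF (P : NFPort) (h₁ : BdvChainExplicitNFR P)
    (h₂ : ∀ (p : ℕ) [Fact p.Prime], 5 ≤ p → ∀ (L : Type) [Field L] [NumberField L],
      IsImaginaryQuadratic L → SatisfiesHeegnerHypothesis p L → NumberField.discr L < -4 →
      Odd (NumberField.discr L) → EisensteinPeriodRatioValuationNF P L p) :
    AFlatFamStatementR := by
  intro W _ _ p _ _ _ _ _ hX h5 hS hns L _ _ hLq hH hHp hd4 hodd hLt Dt Hd w₀ PL hPL hc s k hs hk W' _ D hDf hmin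
    K hK γ I hγ hp N _ f hf ι q Λ c d₁ a A d' z x y perRatio hq hzeta hy hA hcg hd hdd' hR hper0 hper
    ι' κ γ' ΩK Ωp Λf hκ hγ' hΩK hBDP X hXv σ hσ hσ0
  obtain ⟨V, hVcurve, hVnf⟩ := h₁
  have hp1 : (1 : ℝ) < p := by exact_mod_cast (Fact.out : p.Prime).one_lt
  have hp0 : (0 : ℝ) < p := lt_trans one_pos hp1
  -- Step 1: the newform calibrator at `(L, p)` pins `V p d_L = 0`.
  have hV0 : V p (NumberField.discr L) = 0 := by
    obtain ⟨D₁, hX0, hD⟩ := h₂ p h5 L hLq hHp hd4 hodd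
    have h := hVnf p h5 L hLq hHp hd4 hodd D₁
    have hr : D₁.rhs ≠ 0 := by
      rw [← hD]
      exact norm_ne_zero_iff.mpr hX0
    rw [hD] at h
    have h1 : (p : ℝ) ^ (-(V p (NumberField.discr L))) = (p : ℝ) ^ (0 : ℤ) := by
      rw [zpow_zero]
      have h' : (p : ℝ) ^ (-(V p (NumberField.discr L))) * D₁.rhs = 1 * D₁.rhs := by
        rw [one_mul]; exact h.symm
      exact mul_right_cancel₀ hr h'
    have he := zpow_right_injective₀ hp0 hp1.ne' h1
    omega
  -- Step 2: S1's curve conjunct at the target curve, with `V p d_L = 0` and `a_p = −1`.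
  have h := hVcurve W p (nonExceptionalRankOneAt_of_classX11b W p hX hns) h5 hS L hLq hH hHp hd4 hodd hLt Dt Hd w₀
    PL hPL hc s k hs hk W' D hDf hmin K hK γ I hγ hp N f hf ι q Λ c d₁ a A d' z x y perRatio hq hzeta hy hA hcg
    hd hdd' hR hper0 hper ι' κ γ' ΩK Ωp Λf hκ hγ' hΩK hBDP X hXv σ hσ hσ0
  rw [hV0, sub_zero, bdvExplicitExponentR_of_not_split W p hX.2.2.1 hns h5] at h
  exact h

/-! ## §4 The finer split recomposes -/

/-- The finer split recomposes (proved): SUPPLY ∧ REALISABILITY ∧ BSTW ⟹ S2-NF at every admissible `(L, p)`, `p ≥ 5`. -/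
theorem eisensteinPeriodRatioValuationNF_of_supply_of_port (P : NFPort)
    (hsup : ∀ (p : ℕ) [Fact p.Prime], 5 ≤ p → ∀ (L : Type) [Field L] [NumberField L],
      IsImaginaryQuadratic L → SatisfiesHeegnerHypothesis p L → NumberField.discr L < -4 →
      Odd (NumberField.discr L) → CalibratorSupplyNF L p)
    (hreal : CalibratorDataRealisableNF P) (hbstw : BstwIntegralPerrinRiouNF P) :
    ∀ (p : ℕ) [Fact p.Prime], 5 ≤ p → ∀ (L : Type) [Field L] [NumberField L],
      IsImaginaryQuadratic L → SatisfiesHeegnerHypothesis p L → NumberField.discr L < -4 →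
      Odd (NumberField.discr L) → EisensteinPeriodRatioValuationNF P L p := by
  intro p _ h5 L _ _ hLq hHp hd4 hodd
  obtain ⟨D, hX0⟩ := hreal p h5 L hLq hHp hd4 hodd (hsup p h5 L hLq hHp hd4 hodd)
  exact ⟨D, hX0, hbstw p h5 L hLq hHp hd4 hodd D⟩

/-- Corollary: the three print/port pieces and S1-NF give `A♭-fam` (the shape pen g51 re-keys 33169 r2 by import). -/
theorem aFlatFamR_of_bdvChainNFR_of_supply_of_port (P : NFPort) (h₁ : BdvChainExplicitNFR P)
    (hsup : ∀ (p : ℕ) [Fact p.Prime], 5 ≤ p → ∀ (L : Type) [Field L] [NumberField L],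
      IsImaginaryQuadratic L → SatisfiesHeegnerHypothesis p L → NumberField.discr L < -4 →
      Odd (NumberField.discr L) → CalibratorSupplyNF L p)
    (hreal : CalibratorDataRealisableNF P) (hbstw : BstwIntegralPerrinRiouNF P) : AFlatFamStatementR :=
  aFlatFamR_of_bdvChainNFR_of_calibrationNF P h₁ (eisensteinPeriodRatioValuationNF_of_supply_of_port P hsup hreal hbstw)

/-- Sanity: S2-NF is MONOTONE in nothing hidden — with the exact BSTW piece, S1-NF's newform conjunct forces the shift to
vanish wherever a calibrator datum with `X′ ≠ 0` exists (the content of Step 1, isolated). -/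
theorem shift_eq_zero_of_datum (P : NFPort) (V : ℕ → ℤ → ℤ) (hV : BdvChainNFConjunct P V)
    (hbstw : BstwIntegralPerrinRiouNF P) (p : ℕ) [Fact p.Prime] (h5 : 5 ≤ p) (L : Type) [Field L] [NumberField L]
    (hLq : IsImaginaryQuadratic L) (hHp : SatisfiesHeegnerHypothesis p L) (hd4 : NumberField.discr L < -4)
    (hodd : Odd (NumberField.discr L)) (D : NFCalibratorDatum P p L) (hX0 : D.X ≠ 0) :
    V p (NumberField.discr L) = 0 := by
  have hp1 : (1 : ℝ) < p := by exact_mod_cast (Fact.out : p.Prime).one_lt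
  have hp0 : (0 : ℝ) < p := lt_trans one_pos hp1
  have hD := hbstw p h5 L hLq hHp hd4 hodd D
  have h := hV p h5 L hLq hHp hd4 hodd D
  have hr : D.rhs ≠ 0 := by
    rw [← hD]
    exact norm_ne_zero_iff.mpr hX0
  rw [hD] at h
  have h1 : (p : ℝ) ^ (-(V p (NumberField.discr L))) = (p : ℝ) ^ (0 : ℤ) := by
    rw [zpow_zero]
    have h' : (p : ℝ) ^ (-(V p (NumberField.discr L))) * D.rhs = 1 * D.rhs := by
      rw [one_mul]; exact h.symm
    exact mul_right_cancel₀ hr h'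
  have he := zpow_right_injective₀ hp0 hp1.ne' h1
  omega

/-! ## §5 Glues of the registrable single-`P` texts (what the pen's r3 PIECES-on-R-through-NF road docks on) -/

/-- Glue for the two-piece registrable text (proved). -/
theorem aFlatFamR_of_bdvCalibrationNFR (h : BdvCalibrationNFR) : AFlatFamStatementR := by
  obtain ⟨P, h₁, h₂⟩ := h
  exact aFlatFamR_of_bdvChainNFR_of_calibrationNF P h₁ h₂

/-- Glue for the four-piece registrable text (proved). -/
theorem aFlatFamR_of_bdvCalibrationPiecesNFR (h : BdvCalibrationPiecesNFR) : AFlatFamStatementR := by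
  obtain ⟨hsup, P, h₁, hreal, hbstw⟩ := h
  exact aFlatFamR_of_bdvChainNFR_of_supply_of_port P h₁ hsup hreal hbstw

end Summit.BirchSwinnertonDyer.BirchSwinnertonDyer.Theorems.ErratumRoadFiveBdvCalibrationSplitNF

end
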